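import Summits.CriticalPhenomena.PercolationContinuityZ3.Theorems.PercNearOneGluingNoHeavyQuantCornerPrelims
import HarnessLib

/-!
# QUANT lane R8, T-DEC: the CORNER STEP of the flow form of DEC — some witness saturates the corner pair (LEAD-NOTES-G21 N45 (4) CLAIM)

builds on p205010 (kernel theorem, internal audit signed; external expert review pending)

Support file (`--supports stmt-CriticalPhenomena-4575`), QUANT lane typer seat prim-quant-stmt (gen 23), rung R8 of
`run/shared/lean/prim/quant/LADDER.md`.  Theorems only; standard axioms, no sorries.  Continues `…QuantFlowUncross` (p304437: the two
exchange moves `IsFlowAtT.shift`, `IsFlowAtT.uncross`).  This file proves the CLAIM of the lead's corner theorem (N45 (4)) over the kernel's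
`LawDec.FlowAtT`, in the form needed at EVERY stage of the corner run: for a low atom `l₂` (`l₂ ≤ j′`, `2l₂ < T`) above which every low
is spent (a higher low has no mass, or meets only mids without capacity) and a compatible mid `h₁` (`h₁ ≤ min(j′, M)`, `T < l₂ + h₁`) below
which `l₂`'s compatible mids have no capacity — in particular for the HIGHEST low and its LOWEST compatible mid — EVERY feasible instance
has a witness carrying exactly `t* = min(μ l₂, μ h₁ / usage(l₂,h₁))` on `(l₂, h₁)`: the generic move of the south-west corner rule (N45 (2):
the corner run computes the exact LP optimum in 1 675 179 / 1 675 179 census instances).  The definition of the full corner run and the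
induction over it (zero the spent low / the saturated mid and recurse; giants last at rate x/(1−x)) are left to the next file; with this step
they are bookkeeping.

* bookkeeping in `…QuantCornerPrelims` (`IsFlowAtT.le_corner`: `f l₂ h₁ ≤ t*` always; support counts; column-load update).
* **`IsFlowAtT.corner_exchange`** — if `f l₂ h₁ < t*`: the row of `l₂` has another positive entry `h' > h₁`; if the load of `h₁` has
  slack, SHIFT `ε = min(f l₂ h', slack/usage(l₂,h₁), t* − f l₂ h₁)` (`IsFlowAtT.shift`); otherwise a lower low `l' < l₂` sits on `h₁` and the
  MONGE SWAP with `ε = min(f l₂ h', f l' h₁·usage(l',h₁)/usage(l₂,h₁), t* − f l₂ h₁)` applies (`IsFlowAtT.uncross`, `usage_monge`); in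
  each case either `t*` is reached or the potential `#{h ≠ h₁ : f l₂ h > 0} + #{l ≠ l₂ : f l h₁ > 0} + [load(h₁) < μ h₁]` drops.
* **`IsFlowAtT.corner_step`**, **`FlowAtT.corner_step`** — the CLAIM, by induction on the potential.

[this work]; `…QuantLawDecFlows` (typer g22), `…QuantLawDecUsageMonge(Rates)` (lead g21), `…QuantFlowUncross` (this seat).  Corner /
Monge rules for transportation problems are classical (Hoffman 1963); nothing here is cited as a published result.  The gluing rows served
[cite: KozmaNitzan2024, Conjecture 3 (p. 15)]; product measure [cite: Grimmett1999, §1.3 p. 10].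
-/

noncomputable section
namespace Summit.CriticalPhenomena.PercolationContinuityZ3.Theorems
namespace Quant
open Finset
namespace LawDec

/-- **ONE EXCHANGE TOWARDS THE CORNER.**  `l₂` is a low above which every low is spent (`hhigh`: a higher low has no mass or meets only
mids without capacity — vacuous for the highest low) and `h₁ ≤ min(j′, M)` a compatible mid below which the compatible mids have no capacity
(`hbelow` — vacuous for the lowest compatible mid); this is the situation at EVERY stage of the corner run.  If a witness `f` carries
less than `t* = min(μ l₂, μ h₁/usage(l₂,h₁))` on `(l₂,h₁)`, one exchange (a shift into the slack of `h₁`, or a Monge swap with a lower low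
`l′` on `h₁`) gives a witness that reaches `t*` on `(l₂,h₁)` or has strictly smaller potential
`#{h ≠ h₁ : f l₂ h > 0} + #{l ≠ l₂ : f l h₁ > 0} + [load(h₁) < μ h₁]`. [this work] -/
theorem IsFlowAtT.corner_exchange {x T : ℝ} {j' M : ℕ} {μ : ℕ → ℝ} {f : ℕ → ℕ → ℝ} (hF : IsFlowAtT x T j' M μ f)
    (hx0 : 0 < x) (hx1 : x < 1) (l₂ h₁ : ℕ) (hl2 : l₂ ≤ j') (hlow : 2 * (l₂ : ℝ) < T)
    (hhigh : ∀ l h : ℕ, l₂ < l → l ≤ j' → 2 * (l : ℝ) < T → h ≤ j' → h ≤ M → T < (l : ℝ) + h → μ l = 0 ∨ μ h = 0)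
    (hh1j : h₁ ≤ j') (hh1M : h₁ ≤ M) (hcomp : T < (l₂ : ℝ) + h₁)
    (hbelow : ∀ h : ℕ, h < h₁ → h ≤ M → T < (l₂ : ℝ) + h → μ h = 0) (hlt : f l₂ h₁ < min (μ l₂) (μ h₁ / usage x T j' l₂ h₁)) :
    ∃ g : ℕ → ℕ → ℝ, IsFlowAtT x T j' M μ g ∧
      (g l₂ h₁ = min (μ l₂) (μ h₁ / usage x T j' l₂ h₁) ∨
        ((Finset.range (M + 1)).filter (fun h => h ≠ h₁ ∧ 0 < g l₂ h)).card
            + ((Finset.range (j' + 1)).filter (fun l => l ≠ l₂ ∧ 0 < g l h₁)).card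
            + (if ∑ l ∈ Finset.range (j' + 1), usage x T j' l h₁ * g l h₁ < μ h₁ then 1 else 0)
          < ((Finset.range (M + 1)).filter (fun h => h ≠ h₁ ∧ 0 < f l₂ h)).card
            + ((Finset.range (j' + 1)).filter (fun l => l ≠ l₂ ∧ 0 < f l h₁)).card
            + (if ∑ l ∈ Finset.range (j' + 1), usage x T j' l h₁ * f l h₁ < μ h₁ then 1 else 0)) := by
  generalize ht : min (μ l₂) (μ h₁ / usage x T j' l₂ h₁) = t at hlt ⊢
  have hterm := hF.term_nonneg hx0 hx1
  obtain ⟨hf0, hsupp, hrow, hcol⟩ := id hF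
  have ind_nn : ∀ (P : Prop) [Decidable P], (0:ℝ) ≤ (if P then (1:ℝ) else 0) := fun P _ => by
    split_ifs <;> norm_num
  have hlh21 : l₂ < h₁ := by
    by_contra hge
    push Not at hge
    have : (h₁ : ℝ) ≤ l₂ := by exact_mod_cast hge
    linarith
  have hc21 : j' + 1 ≤ h₁ ∨ T < (l₂ : ℝ) + h₁ := Or.inr hcomp
  have habs1 : j' + 1 ≤ h₁ ∨ T ≤ 2 * (h₁ : ℝ) := Or.inr (by linarith)
  have hu21 : 0 < usage x T j' l₂ h₁ := usage_pos_of_compat x T j' l₂ h₁ hx0 hx1 hlow hlh21 hc21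
  have hL : ∑ l ∈ Finset.range (j' + 1), usage x T j' l h₁ * f l h₁ ≤ μ h₁ := hcol h₁ hh1M habs1
  have hl2r : l₂ ∈ Finset.range (j' + 1) := Finset.mem_range.2 (by omega)
  have hh1r : h₁ ∈ Finset.range (M + 1) := Finset.mem_range.2 (by omega)
  have ht1 : t ≤ μ l₂ := ht ▸ min_le_left _ _
  have ht2 : usage x T j' l₂ h₁ * t ≤ μ h₁ := by
    have h2 : t ≤ μ h₁ / usage x T j' l₂ h₁ := ht ▸ min_le_right _ _
    rw [le_div_iff₀ hu21] at h2
    linarith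
  have hC : 0 < t - f l₂ h₁ := by linarith
  -- (a) the row of `l₂` has another positive entry `h'`, above `h₁`
  obtain ⟨h', hh'r, hh'ne, hh'pos⟩ := exists_ne_pos_of_lt_sum (Finset.range (M + 1)) (fun h => f l₂ h) h₁ hh1r
    (by rw [hrow l₂ hl2 hlow]; linarith)
  obtain ⟨-, -, hh'M, hc2'⟩ := hsupp l₂ h' hh'pos
  have habs' : j' + 1 ≤ h' ∨ T ≤ 2 * (h' : ℝ) := by
    rcases hc2' with hg | hm
    · exact Or.inl hg
    · exact Or.inr (by linarith)
  have hh1' : h₁ < h' := by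
    rcases hc2' with hg | hm
    · omega
    · -- a compatible mid below `h₁` has no capacity, so it carries nothing
      by_contra hle
      push Not at hle
      have hlt' : h' < h₁ := lt_of_le_of_ne hle hh'ne
      have hμ0 : μ h' = 0 := hbelow h' hlt' hh'M hm
      have hlh : l₂ < h' := by
        by_contra hge
        push Not at hge
        have : (h' : ℝ) ≤ l₂ := by exact_mod_cast hge
        linarith
      have hu' := usage_pos_of_compat x T j' l₂ h' hx0 hx1 hlow hlh (Or.inr hm)
      have hle' : usage x T j' l₂ h' * f l₂ h' ≤ μ h' :=
        le_trans (Finset.single_le_sum (f := fun l => usage x T j' l h' * f l h') (fun l _ => hterm l h') hl2r)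
          (hcol h' hh'M habs')
      rw [hμ0] at hle'
      have := mul_pos hu' hh'pos
      linarith
  have hne' : h₁ ≠ h' := by omega
  by_cases hslack : ∑ l ∈ Finset.range (j' + 1), usage x T j' l h₁ * f l h₁ < μ h₁
  · -- SLACK CASE: shift `ε` from `(l₂,h')` to `(l₂,h₁)`
    have hB : 0 < (μ h₁ - ∑ l ∈ Finset.range (j' + 1), usage x T j' l h₁ * f l h₁) / usage x T j' l₂ h₁ :=
      div_pos (by linarith) hu21
    obtain ⟨ε, hεdef⟩ : ∃ ε : ℝ, ε = min (f l₂ h')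
        (min ((μ h₁ - ∑ l ∈ Finset.range (j' + 1), usage x T j' l h₁ * f l h₁) / usage x T j' l₂ h₁) (t - f l₂ h₁)) :=
      ⟨_, rfl⟩
    have hε0 : 0 < ε := by rw [hεdef]; exact lt_min hh'pos (lt_min hB hC)
    have hεA : ε ≤ f l₂ h' := by rw [hεdef]; exact min_le_left _ _
    have hεB : ε ≤ (μ h₁ - ∑ l ∈ Finset.range (j' + 1), usage x T j' l h₁ * f l h₁) / usage x T j' l₂ h₁ := by
      rw [hεdef]; exact le_trans (min_le_right _ _) (min_le_left _ _)
    have hεC : ε ≤ t - f l₂ h₁ := by rw [hεdef]; exact le_trans (min_le_right _ _) (min_le_right _ _)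
    have hεB' : ε * usage x T j' l₂ h₁ ≤ μ h₁ - ∑ l ∈ Finset.range (j' + 1), usage x T j' l h₁ * f l h₁ := by
      rwa [le_div_iff₀ hu21] at hεB
    have hG := IsFlowAtT.shift hF hx0 hx1 l₂ h₁ h' hne' hl2 hlow hh1M hc21 ε hε0.le hεA (by linarith)
    refine ⟨_, hG, ?_⟩
    -- values of the new flow
    have v11 : f l₂ h₁ + ε * (if l₂ = l₂ then (1:ℝ) else 0) * (if h₁ = h₁ then (1:ℝ) else 0)
        - ε * (if l₂ = l₂ then (1:ℝ) else 0) * (if h₁ = h' then (1:ℝ) else 0) = f l₂ h₁ + ε := by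
      rw [if_pos rfl, if_pos rfl, if_neg hne']; ring
    have vrow : ∀ h, h ≠ h₁ → f l₂ h + ε * (if l₂ = l₂ then (1:ℝ) else 0) * (if h = h₁ then (1:ℝ) else 0)
        - ε * (if l₂ = l₂ then (1:ℝ) else 0) * (if h = h' then (1:ℝ) else 0)
        = f l₂ h - ε * (if h = h' then (1:ℝ) else 0) := by
      intro h hne; rw [if_pos rfl, if_neg hne]; ring
    have vcol : ∀ l, f l h₁ + ε * (if l = l₂ then (1:ℝ) else 0) * (if h₁ = h₁ then (1:ℝ) else 0)
        - ε * (if l = l₂ then (1:ℝ) else 0) * (if h₁ = h' then (1:ℝ) else 0)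
        = f l h₁ + ε * (if l = l₂ then (1:ℝ) else 0) := by
      intro l; rw [if_pos rfl, if_neg hne']; ring
    have hload : ∑ l ∈ Finset.range (j' + 1), usage x T j' l h₁ * (f l h₁
        + ε * (if l = l₂ then (1:ℝ) else 0) * (if h₁ = h₁ then (1:ℝ) else 0)
        - ε * (if l = l₂ then (1:ℝ) else 0) * (if h₁ = h' then (1:ℝ) else 0))
        = ∑ l ∈ Finset.range (j' + 1), usage x T j' l h₁ * f l h₁ + ε * usage x T j' l₂ h₁ := by
      rw [Finset.sum_congr rfl (fun l _ => by rw [vcol l])]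
      exact sum_usage_add_indicator x T j' h₁ (fun l => f l h₁) l₂ hl2r ε
    have hrowle : ((Finset.range (M + 1)).filter (fun h => h ≠ h₁ ∧ 0 < f l₂ h
          + ε * (if l₂ = l₂ then (1:ℝ) else 0) * (if h = h₁ then (1:ℝ) else 0)
          - ε * (if l₂ = l₂ then (1:ℝ) else 0) * (if h = h' then (1:ℝ) else 0))).card
        ≤ ((Finset.range (M + 1)).filter (fun h => h ≠ h₁ ∧ 0 < f l₂ h)).card := by
      apply card_filter_pos_mono
      intro h _ hne hpos
      rw [vrow h hne] at hpos
      have := mul_nonneg hε0.le (ind_nn (h = h'))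
      linarith
    have hcolle : ((Finset.range (j' + 1)).filter (fun l => l ≠ l₂ ∧ 0 < f l h₁
          + ε * (if l = l₂ then (1:ℝ) else 0) * (if h₁ = h₁ then (1:ℝ) else 0)
          - ε * (if l = l₂ then (1:ℝ) else 0) * (if h₁ = h' then (1:ℝ) else 0))).card
        ≤ ((Finset.range (j' + 1)).filter (fun l => l ≠ l₂ ∧ 0 < f l h₁)).card := by
      apply card_filter_pos_mono
      intro l _ hne hpos
      rw [vcol l, if_neg hne] at hpos
      linarith
    rw [if_pos hslack, hload, v11]
    rcases min_choice (f l₂ h')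
        (min ((μ h₁ - ∑ l ∈ Finset.range (j' + 1), usage x T j' l h₁ * f l h₁) / usage x T j' l₂ h₁) (t - f l₂ h₁))
      with hA | hBC
    · -- ε = f l₂ h' : the entry (l₂,h') dies
      rw [← hεdef] at hA
      right
      have hrowlt : ((Finset.range (M + 1)).filter (fun h => h ≠ h₁ ∧ 0 < f l₂ h
            + ε * (if l₂ = l₂ then (1:ℝ) else 0) * (if h = h₁ then (1:ℝ) else 0)
            - ε * (if l₂ = l₂ then (1:ℝ) else 0) * (if h = h' then (1:ℝ) else 0))).card
          < ((Finset.range (M + 1)).filter (fun h => h ≠ h₁ ∧ 0 < f l₂ h)).card := by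
        apply card_filter_pos_strict _ _ _ _ _ h' hh'r (Ne.symm hne') hh'pos
        · rw [vrow h' (Ne.symm hne'), if_pos rfl, hA]; intro hc; linarith
        · intro h _ hne hpos
          rw [vrow h hne] at hpos
          have := mul_nonneg hε0.le (ind_nn (h = h'))
          linarith
      have hind : (if ∑ l ∈ Finset.range (j' + 1), usage x T j' l h₁ * f l h₁ + ε * usage x T j' l₂ h₁ < μ h₁
          then 1 else 0) ≤ 1 := by split_ifs <;> norm_num
      omega
    · rcases min_choice
          ((μ h₁ - ∑ l ∈ Finset.range (j' + 1), usage x T j' l h₁ * f l h₁) / usage x T j' l₂ h₁) (t - f l₂ h₁)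
        with hB' | hC'
      · -- ε = slack/usage : the slack of h₁ dies
        rw [← hεdef] at hBC; rw [hB'] at hBC
        right
        have hfull : ¬ (∑ l ∈ Finset.range (j' + 1), usage x T j' l h₁ * f l h₁ + ε * usage x T j' l₂ h₁ < μ h₁) := by
          rw [hBC, div_mul_cancel₀ _ hu21.ne']
          intro h; linarith
        rw [if_neg hfull]
        omega
      · -- ε = t − f l₂ h₁ : the corner value is reached
        rw [← hεdef] at hBC; rw [hC'] at hBC
        left
        rw [hBC]; ring
  · -- NO-SLACK CASE: a lower low `l'` sits on `h₁`; Monge swap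
    have hLeq : ∑ l ∈ Finset.range (j' + 1), usage x T j' l h₁ * f l h₁ = μ h₁ := le_antisymm hL (not_lt.1 hslack)
    obtain ⟨l', hl'r, hl'ne, hl'pos⟩ := exists_ne_pos_of_lt_sum (Finset.range (j' + 1))
      (fun l => usage x T j' l h₁ * f l h₁) l₂ hl2r (by
        show usage x T j' l₂ h₁ * f l₂ h₁ < ∑ l ∈ Finset.range (j' + 1), usage x T j' l h₁ * f l h₁
        have := mul_lt_mul_of_pos_left hlt hu21
        rw [hLeq]; linarith)
    have hf1pos : 0 < f l' h₁ := by
      rcases (hf0 l' h₁).lt_or_eq with hpos | h0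
      · exact hpos
      · exfalso
        have : usage x T j' l' h₁ * f l' h₁ = 0 := by rw [← h0, mul_zero]
        simp only [this, lt_self_iff_false] at hl'pos
    obtain ⟨hl'j, hl'low, -, hc1'⟩ := hsupp l' h₁ hf1pos
    have hcomp1 : T < (l' : ℝ) + h₁ := by
      rcases hc1' with hg | hm
      · omega
      · exact hm
    have hl' : l' < l₂ := by
      rcases lt_or_gt_of_ne hl'ne with hlt' | hgt
      · exact hlt'
      · -- a higher low either has no mass or meets only mids without capacity
        exfalso
        rcases hhigh l' h₁ hgt hl'j hl'low hh1j hh1M hcomp1 with hμl | hμh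
        · have hrow' := hrow l' hl'j hl'low
          rw [hμl] at hrow'
          have := Finset.single_le_sum (f := fun h => f l' h) (fun h _ => hf0 l' h) hh1r
          linarith
        · have hle' : usage x T j' l' h₁ * f l' h₁ ≤ μ h₁ :=
            le_trans (Finset.single_le_sum (f := fun l => usage x T j' l h₁ * f l h₁) (fun l _ => hterm l h₁) hl'r) hL
          rw [hμh] at hle'
          linarith
    have hlh11 : l' < h₁ := by omega
    have hu11 : 0 < usage x T j' l' h₁ := usage_pos_of_compat x T j' l' h₁ hx0 hx1 hl'low hlh11 (Or.inr hcomp1)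
    have hB : 0 < f l' h₁ * usage x T j' l' h₁ / usage x T j' l₂ h₁ := div_pos (mul_pos hf1pos hu11) hu21
    obtain ⟨ε, hεdef⟩ : ∃ ε : ℝ, ε = min (f l₂ h')
        (min (f l' h₁ * usage x T j' l' h₁ / usage x T j' l₂ h₁) (t - f l₂ h₁)) := ⟨_, rfl⟩
    have hε0 : 0 < ε := by rw [hεdef]; exact lt_min hh'pos (lt_min hB hC)
    have hεA : ε ≤ f l₂ h' := by rw [hεdef]; exact min_le_left _ _
    have hεB : ε ≤ f l' h₁ * usage x T j' l' h₁ / usage x T j' l₂ h₁ := by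
      rw [hεdef]; exact le_trans (min_le_right _ _) (min_le_left _ _)
    have hεC : ε ≤ t - f l₂ h₁ := by rw [hεdef]; exact le_trans (min_le_right _ _) (min_le_right _ _)
    have hδ : ε * usage x T j' l₂ h₁ ≤ usage x T j' l' h₁ * f l' h₁ := by
      rw [le_div_iff₀ hu21] at hεB; linarith
    have hG := IsFlowAtT.uncross hF hx0 hx1 l' l₂ h₁ h' hl' hh1' hl2 hlow hh'M hcomp1 habs1 ε hε0.le hεA hδ
    refine ⟨_, hG, ?_⟩
    have hne_l : l' ≠ l₂ := by omega
    have hδ0 : 0 ≤ ε * usage x T j' l₂ h₁ / usage x T j' l' h₁ := div_nonneg (mul_nonneg hε0.le hu21.le) hu11.le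
    have hδ1 : ε * usage x T j' l₂ h₁ / usage x T j' l' h₁ * usage x T j' l' h₁ = ε * usage x T j' l₂ h₁ :=
      div_mul_cancel₀ _ hu11.ne'
    -- values of the new flow (generic coefficient `d` for the swapped amount)
    have v11 : ∀ d : ℝ, f l₂ h₁ + ε * (if l₂ = l₂ then (1:ℝ) else 0) * (if h₁ = h₁ then (1:ℝ) else 0)
        - ε * (if l₂ = l₂ then (1:ℝ) else 0) * (if h₁ = h' then (1:ℝ) else 0)
        + d * (if l₂ = l' then (1:ℝ) else 0) * (if h₁ = h' then (1:ℝ) else 0)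
        - d * (if l₂ = l' then (1:ℝ) else 0) * (if h₁ = h₁ then (1:ℝ) else 0) = f l₂ h₁ + ε := by
      intro d; rw [if_pos rfl, if_pos rfl, if_neg hne', if_neg (Ne.symm hne_l)]; ring
    have vrow : ∀ d : ℝ, ∀ h, h ≠ h₁ → f l₂ h + ε * (if l₂ = l₂ then (1:ℝ) else 0) * (if h = h₁ then (1:ℝ) else 0)
        - ε * (if l₂ = l₂ then (1:ℝ) else 0) * (if h = h' then (1:ℝ) else 0)
        + d * (if l₂ = l' then (1:ℝ) else 0) * (if h = h' then (1:ℝ) else 0)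
        - d * (if l₂ = l' then (1:ℝ) else 0) * (if h = h₁ then (1:ℝ) else 0)
        = f l₂ h - ε * (if h = h' then (1:ℝ) else 0) := by
      intro d h hne; rw [if_pos rfl, if_neg hne, if_neg (Ne.symm hne_l)]; ring
    have vcol : ∀ d : ℝ, ∀ l, f l h₁ + ε * (if l = l₂ then (1:ℝ) else 0) * (if h₁ = h₁ then (1:ℝ) else 0)
        - ε * (if l = l₂ then (1:ℝ) else 0) * (if h₁ = h' then (1:ℝ) else 0)
        + d * (if l = l' then (1:ℝ) else 0) * (if h₁ = h' then (1:ℝ) else 0)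
        - d * (if l = l' then (1:ℝ) else 0) * (if h₁ = h₁ then (1:ℝ) else 0)
        = (f l h₁ + ε * (if l = l₂ then (1:ℝ) else 0)) + (-d) * (if l = l' then (1:ℝ) else 0) := by
      intro d l; rw [if_pos rfl, if_neg hne']; ring
    have hload : ∀ d : ℝ, ∑ l ∈ Finset.range (j' + 1), usage x T j' l h₁ * (f l h₁
        + ε * (if l = l₂ then (1:ℝ) else 0) * (if h₁ = h₁ then (1:ℝ) else 0)
        - ε * (if l = l₂ then (1:ℝ) else 0) * (if h₁ = h' then (1:ℝ) else 0)
        + d * (if l = l' then (1:ℝ) else 0) * (if h₁ = h' then (1:ℝ) else 0)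
        - d * (if l = l' then (1:ℝ) else 0) * (if h₁ = h₁ then (1:ℝ) else 0))
        = ∑ l ∈ Finset.range (j' + 1), usage x T j' l h₁ * f l h₁ + ε * usage x T j' l₂ h₁
          + (-d) * usage x T j' l' h₁ := by
      intro d
      rw [Finset.sum_congr rfl (fun l _ => by rw [vcol d l])]
      rw [sum_usage_add_indicator x T j' h₁ (fun l => f l h₁ + ε * (if l = l₂ then (1:ℝ) else 0)) l' hl'r (-d)]
      rw [sum_usage_add_indicator x T j' h₁ (fun l => f l h₁) l₂ hl2r ε]
    have hrowle : ∀ d : ℝ, ((Finset.range (M + 1)).filter (fun h => h ≠ h₁ ∧ 0 < f l₂ h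
          + ε * (if l₂ = l₂ then (1:ℝ) else 0) * (if h = h₁ then (1:ℝ) else 0)
          - ε * (if l₂ = l₂ then (1:ℝ) else 0) * (if h = h' then (1:ℝ) else 0)
          + d * (if l₂ = l' then (1:ℝ) else 0) * (if h = h' then (1:ℝ) else 0)
          - d * (if l₂ = l' then (1:ℝ) else 0) * (if h = h₁ then (1:ℝ) else 0))).card
        ≤ ((Finset.range (M + 1)).filter (fun h => h ≠ h₁ ∧ 0 < f l₂ h)).card := by
      intro d
      apply card_filter_pos_mono
      intro h _ hne hpos
      rw [vrow d h hne] at hpos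
      have := mul_nonneg hε0.le (ind_nn (h = h'))
      linarith
    have hcolle : ∀ d : ℝ, 0 ≤ d → ((Finset.range (j' + 1)).filter (fun l => l ≠ l₂ ∧ 0 < f l h₁
          + ε * (if l = l₂ then (1:ℝ) else 0) * (if h₁ = h₁ then (1:ℝ) else 0)
          - ε * (if l = l₂ then (1:ℝ) else 0) * (if h₁ = h' then (1:ℝ) else 0)
          + d * (if l = l' then (1:ℝ) else 0) * (if h₁ = h' then (1:ℝ) else 0)
          - d * (if l = l' then (1:ℝ) else 0) * (if h₁ = h₁ then (1:ℝ) else 0))).card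
        ≤ ((Finset.range (j' + 1)).filter (fun l => l ≠ l₂ ∧ 0 < f l h₁)).card := by
      intro d hd
      apply card_filter_pos_mono
      intro l _ hne hpos
      rw [vcol d l, if_neg hne] at hpos
      have := mul_nonneg hd (ind_nn (l = l'))
      linarith
    have hload' : ∑ l ∈ Finset.range (j' + 1), usage x T j' l h₁ * f l h₁ + ε * usage x T j' l₂ h₁
          + (-(ε * usage x T j' l₂ h₁ / usage x T j' l' h₁)) * usage x T j' l' h₁
        = ∑ l ∈ Finset.range (j' + 1), usage x T j' l h₁ * f l h₁ := by
      rw [neg_mul, hδ1]; ring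
    rw [if_neg hslack, hload, hload', if_neg hslack, v11]
    rcases min_choice (f l₂ h')
        (min (f l' h₁ * usage x T j' l' h₁ / usage x T j' l₂ h₁) (t - f l₂ h₁)) with hA | hBC
    · -- ε = f l₂ h' : the entry (l₂,h') dies
      rw [← hεdef] at hA
      right
      have hrowlt : ((Finset.range (M + 1)).filter (fun h => h ≠ h₁ ∧ 0 < f l₂ h
            + ε * (if l₂ = l₂ then (1:ℝ) else 0) * (if h = h₁ then (1:ℝ) else 0)
            - ε * (if l₂ = l₂ then (1:ℝ) else 0) * (if h = h' then (1:ℝ) else 0)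
            + (ε * usage x T j' l₂ h₁ / usage x T j' l' h₁) * (if l₂ = l' then (1:ℝ) else 0) * (if h = h' then (1:ℝ) else 0)
            - (ε * usage x T j' l₂ h₁ / usage x T j' l' h₁) * (if l₂ = l' then (1:ℝ) else 0)
                * (if h = h₁ then (1:ℝ) else 0))).card
          < ((Finset.range (M + 1)).filter (fun h => h ≠ h₁ ∧ 0 < f l₂ h)).card := by
        apply card_filter_pos_strict _ _ _ _ _ h' hh'r (Ne.symm hne') hh'pos
        · rw [vrow _ h' (Ne.symm hne'), if_pos rfl, hA]; intro hc; linarith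
        · intro h _ hne hpos
          rw [vrow _ h hne] at hpos
          have := mul_nonneg hε0.le (ind_nn (h = h'))
          linarith
      have := hcolle _ hδ0
      omega
    · rcases min_choice (f l' h₁ * usage x T j' l' h₁ / usage x T j' l₂ h₁) (t - f l₂ h₁) with hB' | hC'
      · -- ε = f l' h₁·u(l',h₁)/u(l₂,h₁) : the entry (l',h₁) dies
        rw [← hεdef] at hBC; rw [hB'] at hBC
        right
        have hδeq : ε * usage x T j' l₂ h₁ / usage x T j' l' h₁ = f l' h₁ := by
          rw [hBC]; field_simp
        have hcollt : ((Finset.range (j' + 1)).filter (fun l => l ≠ l₂ ∧ 0 < f l h₁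
            + ε * (if l = l₂ then (1:ℝ) else 0) * (if h₁ = h₁ then (1:ℝ) else 0)
            - ε * (if l = l₂ then (1:ℝ) else 0) * (if h₁ = h' then (1:ℝ) else 0)
            + (ε * usage x T j' l₂ h₁ / usage x T j' l' h₁) * (if l = l' then (1:ℝ) else 0) * (if h₁ = h' then (1:ℝ) else 0)
            - (ε * usage x T j' l₂ h₁ / usage x T j' l' h₁) * (if l = l' then (1:ℝ) else 0)
                * (if h₁ = h₁ then (1:ℝ) else 0))).card
          < ((Finset.range (j' + 1)).filter (fun l => l ≠ l₂ ∧ 0 < f l h₁)).card := by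
          apply card_filter_pos_strict _ _ _ _ _ l' hl'r hne_l hf1pos
          · rw [vcol _ l', if_neg hne_l, if_pos rfl, hδeq]; intro hc; linarith
          · intro l _ hne hpos
            rw [vcol _ l, if_neg hne] at hpos
            have := mul_nonneg hδ0 (ind_nn (l = l'))
            linarith
        have := hrowle (ε * usage x T j' l₂ h₁ / usage x T j' l' h₁)
        omega
      · -- ε = t − f l₂ h₁ : the corner value is reached
        rw [← hεdef] at hBC; rw [hC'] at hBC
        left
        rw [hBC]; ring

/-- **THE CORNER STEP (N45 (4) CLAIM).**  For a low `l₂` above which every low is spent and a compatible mid `h₁ ≤ min(j′, M)` below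
which `l₂`'s mids have no capacity (in particular: the highest low and its lowest compatible mid), every feasible instance has a witness
carrying EXACTLY `min(μ l₂, μ h₁/usage(l₂,h₁))` on `(l₂,h₁)` — the generic move of the corner rule.  Proof: iterate `corner_exchange`; the
potential is a natural number. [this work] -/
theorem IsFlowAtT.corner_step {x T : ℝ} {j' M : ℕ} {μ : ℕ → ℝ} {f : ℕ → ℕ → ℝ} (hF : IsFlowAtT x T j' M μ f)
    (hx0 : 0 < x) (hx1 : x < 1) (l₂ h₁ : ℕ) (hl2 : l₂ ≤ j') (hlow : 2 * (l₂ : ℝ) < T)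
    (hhigh : ∀ l h : ℕ, l₂ < l → l ≤ j' → 2 * (l : ℝ) < T → h ≤ j' → h ≤ M → T < (l : ℝ) + h → μ l = 0 ∨ μ h = 0)
    (hh1j : h₁ ≤ j') (hh1M : h₁ ≤ M) (hcomp : T < (l₂ : ℝ) + h₁)
    (hbelow : ∀ h : ℕ, h < h₁ → h ≤ M → T < (l₂ : ℝ) + h → μ h = 0) :
    ∃ g : ℕ → ℕ → ℝ, IsFlowAtT x T j' M μ g ∧ g l₂ h₁ = min (μ l₂) (μ h₁ / usage x T j' l₂ h₁) := by
  suffices H : ∀ n : ℕ, ∀ g : ℕ → ℕ → ℝ, IsFlowAtT x T j' M μ g →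
      ((Finset.range (M + 1)).filter (fun h => h ≠ h₁ ∧ 0 < g l₂ h)).card
          + ((Finset.range (j' + 1)).filter (fun l => l ≠ l₂ ∧ 0 < g l h₁)).card
          + (if ∑ l ∈ Finset.range (j' + 1), usage x T j' l h₁ * g l h₁ < μ h₁ then 1 else 0) ≤ n →
      ∃ g' : ℕ → ℕ → ℝ, IsFlowAtT x T j' M μ g' ∧ g' l₂ h₁ = min (μ l₂) (μ h₁ / usage x T j' l₂ h₁) from
    H _ f hF le_rfl
  intro n
  induction n with
  | zero =>
    intro g hg hm
    rcases (hg.le_corner hx0 hx1 l₂ h₁ hl2 hlow hh1M hcomp).eq_or_lt with heq | hlt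
    · exact ⟨g, hg, heq⟩
    · obtain ⟨g', hg', hres⟩ := hg.corner_exchange hx0 hx1 l₂ h₁ hl2 hlow hhigh hh1j hh1M hcomp hbelow hlt
      rcases hres with heq | hdec
      · exact ⟨g', hg', heq⟩
      · omega
  | succ n ih =>
    intro g hg hm
    rcases (hg.le_corner hx0 hx1 l₂ h₁ hl2 hlow hh1M hcomp).eq_or_lt with heq | hlt
    · exact ⟨g, hg, heq⟩
    · obtain ⟨g', hg', hres⟩ := hg.corner_exchange hx0 hx1 l₂ h₁ hl2 hlow hhigh hh1j hh1M hcomp hbelow hlt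
      rcases hres with heq | hdec
      · exact ⟨g', hg', heq⟩
      · exact ih g' hg' (by omega)

/-- `FlowAtT` form of the corner step. [this work] -/
theorem FlowAtT.corner_step {x T : ℝ} {j' M : ℕ} {μ : ℕ → ℝ} (hF : FlowAtT x T j' M μ)
    (hx0 : 0 < x) (hx1 : x < 1) (l₂ h₁ : ℕ) (hl2 : l₂ ≤ j') (hlow : 2 * (l₂ : ℝ) < T)
    (hhigh : ∀ l h : ℕ, l₂ < l → l ≤ j' → 2 * (l : ℝ) < T → h ≤ j' → h ≤ M → T < (l : ℝ) + h → μ l = 0 ∨ μ h = 0)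
    (hh1j : h₁ ≤ j') (hh1M : h₁ ≤ M) (hcomp : T < (l₂ : ℝ) + h₁)
    (hbelow : ∀ h : ℕ, h < h₁ → h ≤ M → T < (l₂ : ℝ) + h → μ h = 0) :
    ∃ g : ℕ → ℕ → ℝ, IsFlowAtT x T j' M μ g ∧ g l₂ h₁ = min (μ l₂) (μ h₁ / usage x T j' l₂ h₁) := by
  obtain ⟨f, hf⟩ := (flowAtT_iff_exists_isFlowAtT x T j' M μ).1 hF
  exact hf.corner_step hx0 hx1 l₂ h₁ hl2 hlow hhigh hh1j hh1M hcomp hbelow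

end LawDec

end Quant

end Summit.CriticalPhenomena.PercolationContinuityZ3.Theorems
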